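import Summits.Schanuel.Schanuel.Theorems.ZilberEacSteepestEdgePlaces
import Summits.Schanuel.Schanuel.Theorems.ZilberEacMonicCurvePolyFibres
import HarnessLib

/-!
# Arbitrary base branches, LXII: RATIONAL fibres over monic plane curves WITHOUT a place
# hypothesis — every irreducible surface through the graph of `R/Q` over `F = 0`

HONEST FRAMING.  Cell `pub-schanuel` (Zilber's Exponential-Algebraic Closedness, case ladder;
host summit Schanuel), seat 2, gen 31.  Along a place at infinity of the monic irreducible curve
`C : F(x₀, x₁) = 0` with a good direction, EVERY irreducible surface `S` of dimension `≤ 2`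
containing the points `(x, R(x)/Q(x), e^{x₁})`, `x ∈ C`, `Q(x) ≠ 0`, has Zariski-dense exponential
points (`R`, `Q` nonzero somewhere on `C`): the values of `R` and `Q` along the place are
`ψ_R(s)s^{L_R}`, `ψ_Q(s)s^{L_Q}` (file LIV), so `R/Q = (ψ_R/ψ_Q)s^{L_R − L_Q}` feeds the pole-fibre
engine of file XXXII (**`unprojectedDense_monicCurve_rationalFibre_of_place`**, the place given with
its leading coefficient `θ = Φ(0)`).  Files LX (a)/(b) construct the place, so the place hypothesis is
replaced by Newton-polygon data exactly as in file LXI: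
**`unprojectedDense_monicCurve_rationalFibre_of_edgeRoot`** (steepest edge, a root `θ` of the edge
polynomial with `Re(θ z^M) ≠ 0`, `z^k = 2πi`) and
**`unprojectedDense_monicCurve_rationalFibre_of_steepestEdge_not_dvd`** (edge attained, `k ∤ 2M`:
NO direction hypothesis).  Decided instances of an OPEN question (Mantova–Masser, PLMS 2024 §1
p. 5); EC(3,2) OPEN; NOT Schanuel's conjecture (neither used nor implied); EAC ⇏ SC.
-/

noncomputable section

open Filter Topology Set Complex Polynomial
open Literature.NumberTheory.Transcendental Literature.ModelTheory.Zilber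
open Literature.ModelTheory.ExponentialFields

set_option linter.dupNamespace false

namespace Summit.Schanuel.Schanuel.Theorems

section MonicCurveRationalAll

variable (F : ℂ[X][X])

/-- **Rational fibres along a place with a good direction** (`F` monic irreducible of positive
`x₁`-degree; the place `x₀ = s^{-k}`, `x₁ = Φ(s)s^{-M}`, `k, M ≥ 1`, `Φ(0) = θ` with
`Re(θ z^M) ≠ 0` for some `z^k = 2πi`; `R, Q` nonzero somewhere on the curve; `S` irreducible of
dimension `≤ 2` containing the graph of `(R/Q, e^{x₁})` over the curve off `Q = 0`): `S` has
Zariski-dense exponential points. [cite: MantovaMasser2023, §1 Further remarks, p. 5 (the question,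
open in general)] (new in this form) -/
theorem unprojectedDense_monicCurve_rationalFibre_of_place (hFm : F.Monic) (hFirr : Irreducible F)
    (hn : 1 ≤ F.natDegree) {k M : ℕ} (hk : 1 ≤ k) (hM : 1 ≤ M) {Φ : ℂ → ℂ} {θ : ℂ}
    (hΦan : AnalyticAt ℂ Φ 0) (hΦ0 : Φ 0 = θ)
    (hplace : ∀ᶠ s in 𝓝[≠] (0 : ℂ),
      (F.map (Polynomial.evalRingHom (s ^ k)⁻¹)).eval (Φ s * (s ^ M)⁻¹) = 0)
    (hdir : ∃ z : ℂ, z ^ k = 2 * Real.pi * I ∧ (θ * z ^ M).re ≠ 0)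
    (R Q : MvPolynomial (Fin 2) ℂ)
    (hR : ∃ x y : ℂ, (F.map (Polynomial.evalRingHom x)).eval y = 0 ∧ MvPolynomial.eval ![x, y] R ≠ 0)
    (hQ : ∃ x y : ℂ, (F.map (Polynomial.evalRingHom x)).eval y = 0 ∧ MvPolynomial.eval ![x, y] Q ≠ 0)
    {S : Set (Fin 2 ⊕ Fin 2 → ℂ)} (hS : IsIrreducibleClosed ℂ S) (hdim : zariskiDim ℂ S ≤ (2 : ℕ))
    (hsub : ∀ x y : ℂ, (F.map (Polynomial.evalRingHom x)).eval y = 0 →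
      MvPolynomial.eval ![x, y] Q ≠ 0 →
      (Sum.elim ![x, y] ![MvPolynomial.eval ![x, y] R / MvPolynomial.eval ![x, y] Q, Complex.exp y] :
        Fin 2 ⊕ Fin 2 → ℂ) ∈ S) :
    UnprojectedDense S := by
  classical
  obtain ⟨GR, hGRdeg, hGRev⟩ := exists_rows_reduction_monic F hFm hn R
  obtain ⟨GQ, hGQdeg, hGQev⟩ := exists_rows_reduction_monic F hFm hn Q
  have hGR0 : GR ≠ 0 := by
    intro hG
    obtain ⟨x, y, hxy, hne⟩ := hR
    apply hne
    rw [hGRev x y hxy, hG, Polynomial.map_zero, Polynomial.eval_zero]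
  have hGQ0 : GQ ≠ 0 := by
    intro hG
    obtain ⟨x, y, hxy, hne⟩ := hQ
    apply hne
    rw [hGQev x y hxy, hG, Polynomial.map_zero, Polynomial.eval_zero]
  obtain ⟨ψR, LR, hψRan, hψR0, hfR⟩ := exists_place_normalForm F hFm hFirr GR hGR0 hGRdeg hk M hΦan hplace
  obtain ⟨ψQ, LQ, hψQan, hψQ0, hfQ⟩ := exists_place_normalForm F hFm hFirr GQ hGQ0 hGQdeg hk M hΦan hplace
  have hψQne : ∀ᶠ s in 𝓝 (0 : ℂ), ψQ s ≠ 0 := hψQan.continuousAt.eventually_ne hψQ0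
  have hdir' : ∃ z : ℂ, z ^ k = 2 * Real.pi * I ∧ (Φ 0 * z ^ M).re ≠ 0 := by rw [hΦ0]; exact hdir
  refine unprojectedDense_branch_poleFibre_of_exists_direction hS hdim hk hM (LR - LQ)
    (hψRan.div hψQan hψQ0) (div_ne_zero hψR0 hψQ0) hΦan hdir' ?_
  filter_upwards [hplace, hfR, hfQ, eventually_nhdsWithin_of_eventually_nhds hψQne, self_mem_nhdsWithin]
    with s hs hRs hQs hψQs hs0
  have hs0' : s ≠ 0 := hs0
  have hQne : MvPolynomial.eval ![(s ^ k)⁻¹, Φ s * (s ^ M)⁻¹] Q ≠ 0 := by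
    rw [hGQev _ _ hs, hQs]
    exact mul_ne_zero hψQs (zpow_ne_zero _ hs0')
  have hpt := hsub _ _ hs hQne
  have hval : MvPolynomial.eval ![(s ^ k)⁻¹, Φ s * (s ^ M)⁻¹] R /
      MvPolynomial.eval ![(s ^ k)⁻¹, Φ s * (s ^ M)⁻¹] Q = ψR s / ψQ s * s ^ (LR - LQ) := by
    rw [hGRev _ _ hs, hGQev _ _ hs, hRs, hQs, zpow_sub₀ hs0']
    field_simp
  rw [hval] at hpt
  exact hpt

/-- **Rational fibres over a monic irreducible curve, steepest edge with a good direction.**  `F`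
monic irreducible of positive `x₁`-degree `n`; weights `(k, M)`, `k, M ≥ 1`, `k·deg f_j ≤ M(n - j)`
for `j < n`; `θ` a root of the edge polynomial with `Re(θ z^M) ≠ 0` for some `z^k = 2πi`; `R`, `Q`
nonzero somewhere on the curve; `S` irreducible of dimension `≤ 2` containing the graph of
`(R/Q, e^{x₁})` over the curve off `Q = 0`: `S` has Zariski-dense exponential points.
[cite: MantovaMasser2023, §1 Further remarks, p. 5 (the question, open in general)] (new) -/
theorem unprojectedDense_monicCurve_rationalFibre_of_edgeRoot (hFm : F.Monic) (hFirr : Irreducible F)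
    (hn : 1 ≤ F.natDegree) {k M : ℕ} (hk : 1 ≤ k) (hM : 1 ≤ M)
    (hmax : ∀ j, j < F.natDegree → (F.coeff j).natDegree * k ≤ M * (F.natDegree - j))
    {E : ℂ[X]} (hE : ∀ j, E.coeff j =
      if (F.coeff j).natDegree * k = M * (F.natDegree - j) then (F.coeff j).leadingCoeff else 0)
    {θ : ℂ} (hEθ : E.IsRoot θ) (hdir : ∃ z : ℂ, z ^ k = 2 * Real.pi * I ∧ (θ * z ^ M).re ≠ 0)
    (R Q : MvPolynomial (Fin 2) ℂ)
    (hR : ∃ x y : ℂ, (F.map (Polynomial.evalRingHom x)).eval y = 0 ∧ MvPolynomial.eval ![x, y] R ≠ 0)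
    (hQ : ∃ x y : ℂ, (F.map (Polynomial.evalRingHom x)).eval y = 0 ∧ MvPolynomial.eval ![x, y] Q ≠ 0)
    {S : Set (Fin 2 ⊕ Fin 2 → ℂ)} (hS : IsIrreducibleClosed ℂ S) (hdim : zariskiDim ℂ S ≤ (2 : ℕ))
    (hsub : ∀ x y : ℂ, (F.map (Polynomial.evalRingHom x)).eval y = 0 →
      MvPolynomial.eval ![x, y] Q ≠ 0 →
      (Sum.elim ![x, y] ![MvPolynomial.eval ![x, y] R / MvPolynomial.eval ![x, y] Q, Complex.exp y] :
        Fin 2 ⊕ Fin 2 → ℂ) ∈ S) :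
    UnprojectedDense S := by
  obtain ⟨e, Φ, he, hΦan, hΦ0, hplace⟩ := exists_place_of_edgeRoot F hFm
    (exists_bezout_derivative hFirr (by omega)) hk hmax hE hEθ
  exact unprojectedDense_monicCurve_rationalFibre_of_place F hFm hFirr hn (Nat.mul_le_mul he hk)
    (Nat.mul_le_mul he hM) hΦan hΦ0 hplace (exists_direction_mul he hdir) R Q hR hQ hS hdim hsub

/-- **Rational fibres by the row-degree criterion.**  As above with the edge attained at some
`j < n` (`f_j ≠ 0`) and `k ∤ 2M`: NO direction hypothesis — every irreducible surface `S` of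
dimension `≤ 2` containing the graph of `(R/Q, e^{x₁})` over the curve off `Q = 0` has Zariski-dense
exponential points. [cite: MantovaMasser2023, §1 Further remarks, p. 5 (the question, open in
general)] (new) -/
theorem unprojectedDense_monicCurve_rationalFibre_of_steepestEdge_not_dvd (hFm : F.Monic)
    (hFirr : Irreducible F) (hn : 1 ≤ F.natDegree) {k M : ℕ} (hk : 1 ≤ k)
    (hmax : ∀ j, j < F.natDegree → (F.coeff j).natDegree * k ≤ M * (F.natDegree - j))
    (hatt : ∃ j, j < F.natDegree ∧ F.coeff j ≠ 0 ∧
      (F.coeff j).natDegree * k = M * (F.natDegree - j))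
    (hkM : ¬ k ∣ 2 * M) (R Q : MvPolynomial (Fin 2) ℂ)
    (hR : ∃ x y : ℂ, (F.map (Polynomial.evalRingHom x)).eval y = 0 ∧ MvPolynomial.eval ![x, y] R ≠ 0)
    (hQ : ∃ x y : ℂ, (F.map (Polynomial.evalRingHom x)).eval y = 0 ∧ MvPolynomial.eval ![x, y] Q ≠ 0)
    {S : Set (Fin 2 ⊕ Fin 2 → ℂ)} (hS : IsIrreducibleClosed ℂ S) (hdim : zariskiDim ℂ S ≤ (2 : ℕ))
    (hsub : ∀ x y : ℂ, (F.map (Polynomial.evalRingHom x)).eval y = 0 →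
      MvPolynomial.eval ![x, y] Q ≠ 0 →
      (Sum.elim ![x, y] ![MvPolynomial.eval ![x, y] R / MvPolynomial.eval ![x, y] Q, Complex.exp y] :
        Fin 2 ⊕ Fin 2 → ℂ) ∈ S) :
    UnprojectedDense S := by
  obtain ⟨θ, e, Φ, hθ0, he, hΦan, hΦ0, hplace⟩ := exists_place_of_steepestEdge F hFm
    (exists_bezout_derivative hFirr (by omega)) hk hmax hatt
  have hM : 1 ≤ M := by
    rcases Nat.eq_zero_or_pos M with h | h
    · exact absurd (by rw [h, mul_zero]; exact dvd_zero k) hkM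
    · exact h
  exact unprojectedDense_monicCurve_rationalFibre_of_place F hFm hFirr hn (Nat.mul_le_mul he hk)
    (Nat.mul_le_mul he hM) hΦan hΦ0 hplace (exists_direction_mul he (exists_direction_of_not_dvd hk hkM hθ0))
    R Q hR hQ hS hdim hsub

end MonicCurveRationalAll

end Summit.Schanuel.Schanuel.Theorems

end
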